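import Summits.Ventures.CertifiedManyBodySolver.Theorems.M3x2EdgeSplitSymReplayOutRouteMFD
import Mathlib.Data.Nat.Log
import HarnessLib

/-!
# SymReplay — lever (κ) KRONECKER DOT: a dense integer dot as ONE big-number product (core `Nat` ops, native under the interpreter)

(team lb-sym, cell hub-lb; hub-lb-sym-eng-4 g3, 2026-08-28; ADDITIVE on `…OutRouteMFD` (dense rows `dvN`, `ddot`); nothing landed is
touched.)

WHY (measured, STATUS «κ BENCH»).  After β⁺ the per-hit Gram dot is `ddot u v = (zipWith (·*·) u v).sum` — native, but a LIST
traversal: 0.19 µs per element whatever the entry size (cons cells), i.e. ≈ 19.5 µs per product at the E₁ factor ranks (r̄ = 102.6),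
the largest single item of the per-product bill after α-T.  KRONECKER SUBSTITUTION packs a row ONCE per module into one natural
number (digits = entries offset by `M`, base `X = 2^b` with `r·(2M)² < X`), so that the dot of two rows is the MIDDLE DIGIT of one
product `lo(u) · hi(v)` — one GMP multiplication + one shift + one mask.  MEASURED per dot (interpreted): synthetic K-32-class
dense rows (|entry| < 2^29, the E₁ factor's digit class; `b` = 65–68) r = 32 / 64 / 100 / 148 / 233: `ddot` 9 / 14 / 21 / 33 / 41 µs →
`kdot` 3 / 3 / 8 / 8 / 15 µs (÷3–4); rung-V block 0 (130 × 39-bit entries, `b` = 84): 22 → 14 µs per dot in isolation but NO gain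
inside the enumerator (module body 15.6 vs 15.8 s) — the lever is for the E₁ shape, to be confirmed by one bench on the real rows.

WHAT.  (a) little-endian digit evaluation `evalLE`, schoolbook list product `mulL` with `evalLE_mulL`, per-coefficient bounds, the
digit-extraction lemma `digit_evalLE`, the middle-coefficient lemma `getD_mulL_reverse` ⇒ **`kron_dotN`**: for digit lists `d e` of
length `r+1` bounded by `B` with `(r+1)·B·B < X`, `evalLE X d * evalLE X e.reverse / X^r % X = (zipWith (·*·) d e).sum`.  (b) the signed
version by offset: `KRow` = (lo, hi, Σ entries), `mkKRow`, **`kdot`** (shift + mask executable), `ddot_eq_offset`, **`kdot_mkKRow`**: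
`kdot b M r (mkKRow b M u) (mkKRow b M v) = ddot u v` for rows of length `r` with `|entries| < M` and `r·(2M)·(2M) < 2^b`.  Module
`…OutRouteMFK` puts it in the enumerator (twin of `shareRFastMFD`).  Std axioms; no `native_decide`.

HONEST FRAMING: an interpreted replay-COST lever with its equality proof; certifies nothing; no bound of record moves; no summit or
crux statement is proved here; nothing here predicts superconductivity.
-/

namespace Summit.Ventures.CertifiedManyBodySolver.Theorems.SymReplay

/-! ##### (a) digit lists: evaluation, schoolbook product, digit extraction, middle coefficient -/

/-- Little-endian evaluation of a digit list at base `X`: `Σᵢ dᵢ·X^i`. -/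
def evalLE (X : ℕ) : List ℕ → ℕ
  | [] => 0
  | d :: ds => d + X * evalLE X ds

/-- Coefficient-wise sum of digit lists. -/
def addL : List ℕ → List ℕ → List ℕ
  | [], l => l
  | l, [] => l
  | a :: u, b :: v => (a + b) :: addL u v

/-- Schoolbook product of digit lists (coefficients of the product polynomial, NO carries). -/
def mulL : List ℕ → List ℕ → List ℕ
  | [], _ => []
  | a :: u, v => addL (v.map (a * ·)) (0 :: mulL u v)

/-- `evalLE` of `addL`. -/
theorem evalLE_addL (X : ℕ) : ∀ (u v : List ℕ), evalLE X (addL u v) = evalLE X u + evalLE X v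
  | [], v => by simp [addL, evalLE]
  | a :: u, [] => by simp [addL, evalLE]
  | a :: u, b :: v => by rw [addL, evalLE, evalLE, evalLE, evalLE_addL X u v]; ring

/-- `evalLE` of a scalar multiple. -/
theorem evalLE_smul (X a : ℕ) : ∀ (v : List ℕ), evalLE X (v.map (a * ·)) = a * evalLE X v
  | [] => by simp [evalLE]
  | b :: v => by rw [List.map_cons, evalLE, evalLE, evalLE_smul X a v]; ring

/-- **`evalLE` is multiplicative on the schoolbook product.** -/
theorem evalLE_mulL (X : ℕ) : ∀ (u v : List ℕ), evalLE X (mulL u v) = evalLE X u * evalLE X v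
  | [], v => by simp [mulL, evalLE]
  | a :: u, v => by rw [mulL, evalLE_addL, evalLE_smul, evalLE, evalLE_mulL X u v, evalLE]; ring

/-- Entries of `addL` are bounded by the sum of the bounds. -/
theorem addL_bound : ∀ (u v : List ℕ) (P Q : ℕ), (∀ x ∈ u, x ≤ P) → (∀ x ∈ v, x ≤ Q) → ∀ x ∈ addL u v, x ≤ P + Q
  | [], v, P, Q, _, hv => fun x hx => by rw [addL] at hx; exact le_trans (hv x hx) (Nat.le_add_left Q P)
  | a :: u, [], P, Q, hu, _ => fun x hx => by
    have hx' : x ∈ a :: u := by simpa [addL] using hx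
    exact le_trans (hu x hx') (Nat.le_add_right P Q)
  | a :: u, b :: v, P, Q, hu, hv => fun x hx => by
    rw [addL, List.mem_cons] at hx
    rcases hx with rfl | hx
    · exact Nat.add_le_add (hu a List.mem_cons_self) (hv b List.mem_cons_self)
    · exact addL_bound u v P Q (fun y hy => hu y (List.mem_cons_of_mem _ hy)) (fun y hy => hv y (List.mem_cons_of_mem _ hy)) x hx

/-- **Coefficient bound of the schoolbook product**: every entry is at most `|u|·P·Q`. -/
theorem mulL_bound : ∀ (u v : List ℕ) (P Q : ℕ), (∀ x ∈ u, x ≤ P) → (∀ x ∈ v, x ≤ Q) → ∀ x ∈ mulL u v, x ≤ u.length * P * Q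
  | [], v, P, Q, _, _ => fun x hx => by simp [mulL] at hx
  | a :: u, v, P, Q, hu, hv => by
    intro x hx
    rw [mulL] at hx
    have h1 : ∀ y ∈ v.map (a * ·), y ≤ P * Q := fun y hy => by
      obtain ⟨z, hz, rfl⟩ := List.mem_map.1 hy
      exact Nat.mul_le_mul (hu a List.mem_cons_self) (hv z hz)
    have h2 : ∀ y ∈ (0 :: mulL u v), y ≤ u.length * P * Q := fun y hy => by
      rcases List.mem_cons.1 hy with rfl | hy
      · exact Nat.zero_le _
      · exact mulL_bound u v P Q (fun z hz => hu z (List.mem_cons_of_mem _ hz)) hv y hy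
    have := addL_bound _ _ _ _ h1 h2 x hx
    rw [List.length_cons]
    calc x ≤ P * Q + u.length * P * Q := this
      _ = (u.length + 1) * P * Q := by ring

/-- **Digit extraction**: with every coefficient below the base, digit `k` of the evaluation is coefficient `k`. -/
theorem digit_evalLE (X : ℕ) (hX : 0 < X) : ∀ (cs : List ℕ) (k : ℕ), (∀ c ∈ cs, c < X) → evalLE X cs / X ^ k % X = cs.getD k 0
  | [], k, _ => by simp [evalLE]
  | c :: cs, 0, h => by
    rw [evalLE, pow_zero, Nat.div_one, List.getD_cons_zero, Nat.add_mul_mod_self_left, Nat.mod_eq_of_lt (h c List.mem_cons_self)]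
  | c :: cs, k + 1, h => by
    rw [evalLE, List.getD_cons_succ, pow_succ', ← Nat.div_div_eq_div_mul, Nat.add_mul_div_left _ _ hX,
      Nat.div_eq_of_lt (h c List.mem_cons_self), zero_add]
    exact digit_evalLE X hX cs k fun c' hc' => h c' (List.mem_cons_of_mem _ hc')

/-- Coefficients of `addL`. -/
theorem getD_addL : ∀ (u v : List ℕ) (k : ℕ), (addL u v).getD k 0 = u.getD k 0 + v.getD k 0
  | [], v, k => by simp [addL]
  | a :: u, [], k => by simp [addL]
  | a :: u, b :: v, 0 => by simp [addL]
  | a :: u, b :: v, k + 1 => by rw [addL, List.getD_cons_succ, List.getD_cons_succ, List.getD_cons_succ, getD_addL u v k]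

/-- Coefficients of a scalar multiple. -/
theorem getD_smul (a : ℕ) : ∀ (v : List ℕ) (k : ℕ), (v.map (a * ·)).getD k 0 = a * v.getD k 0
  | [], k => by simp
  | b :: v, 0 => by simp
  | b :: v, k + 1 => by rw [List.map_cons, List.getD_cons_succ, List.getD_cons_succ, getD_smul a v k]

/-- Coefficient `k+1` of `mulL (a :: u) v`. -/
theorem getD_mulL_cons_succ (a : ℕ) (u v : List ℕ) (k : ℕ) :
    (mulL (a :: u) v).getD (k + 1) 0 = a * v.getD (k + 1) 0 + (mulL u v).getD k 0 := by
  rw [mulL, getD_addL, getD_smul, List.getD_cons_succ]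

/-- Coefficient `0` of `mulL (a :: u) v`. -/
theorem getD_mulL_cons_zero (a : ℕ) (u v : List ℕ) : (mulL (a :: u) v).getD 0 0 = a * v.getD 0 0 := by
  rw [mulL, getD_addL, getD_smul, List.getD_cons_zero, add_zero]

/-- Appending a high digit to the second factor does not move the low coefficients. -/
theorem getD_mulL_append : ∀ (u w : List ℕ) (b k : ℕ), k < w.length → (mulL u (w ++ [b])).getD k 0 = (mulL u w).getD k 0
  | [], w, b, k, _ => by simp [mulL]
  | a :: u, w, b, 0, hk => by
    rw [getD_mulL_cons_zero, getD_mulL_cons_zero, List.getD_eq_getElem?_getD, List.getD_eq_getElem?_getD,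
      List.getElem?_append_left hk]
  | a :: u, w, b, k + 1, hk => by
    rw [getD_mulL_cons_succ, getD_mulL_cons_succ, List.getD_eq_getElem?_getD, List.getElem?_append_left hk,
      ← List.getD_eq_getElem?_getD, getD_mulL_append u w b k (Nat.lt_of_succ_lt hk)]

/-- The natural-number dot of two digit lists. -/
def ddotN (d e : List ℕ) : ℕ := (List.zipWith (· * ·) d e).sum

/-- **Middle coefficient = dot**: coefficient `r` of `mulL d e.reverse` for lists of length `r + 1`. -/
theorem getD_mulL_reverse : ∀ (r : ℕ) (d e : List ℕ), d.length = r + 1 → e.length = r + 1 →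
    (mulL d e.reverse).getD r 0 = ddotN d e
  | r, [], e, hd, _ => by simp at hd
  | r, a :: d, [], _, he => by simp at he
  | 0, a :: d, b :: e, hd, he => by
    have hd' : d = [] := List.eq_nil_of_length_eq_zero (by simpa using hd)
    have he' : e = [] := List.eq_nil_of_length_eq_zero (by simpa using he)
    subst hd' he'
    simp [mulL, addL, ddotN]
  | r + 1, a :: d, b :: e, hd, he => by
    have hdl : d.length = r + 1 := by simpa using hd
    have hel : e.length = r + 1 := by simpa using he
    rw [List.reverse_cons, getD_mulL_cons_succ, getD_mulL_append d e.reverse b r (by rw [List.length_reverse]; omega),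
      getD_mulL_reverse r d e hdl hel]
    -- the appended digit sits at position `r + 1 = |e.reverse|`
    have hb : (e.reverse ++ [b]).getD (r + 1) 0 = b := by
      rw [List.getD_eq_getElem?_getD, List.getElem?_append_right (by rw [List.length_reverse]; omega), List.length_reverse, hel,
        Nat.sub_self]
      rfl
    rw [hb, ddotN, ddotN, List.zipWith_cons_cons, List.sum_cons]

/-- **KRONECKER DOT (naturals)**: for digit lists of length `r + 1` with entries `≤ B` and `(r+1)·B·B < X`, the middle digit of
`evalLE X d · evalLE X e.reverse` in base `X` is their dot product. -/
theorem kron_dotN (X r B : ℕ) (d e : List ℕ) (hd : d.length = r + 1) (he : e.length = r + 1) (hbd : ∀ x ∈ d, x ≤ B)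
    (hbe : ∀ x ∈ e, x ≤ B) (hX : (r + 1) * B * B < X) :
    evalLE X d * evalLE X e.reverse / X ^ r % X = ddotN d e := by
  have hX0 : 0 < X := by omega
  rw [← evalLE_mulL, digit_evalLE X hX0 _ r, getD_mulL_reverse r d e hd he]
  intro c hc
  have := mulL_bound d e.reverse B B hbd (fun x hx => hbe x (List.mem_reverse.1 hx)) c hc
  rw [hd] at this
  omega

/-! ##### (b) signed rows by offset; the executable -/

/-- A Kronecker-encoded row: little-endian and big-endian packings of the offset entries, and the plain entry sum. -/
structure KRow where
  /-- `Σᵢ (uᵢ + M)·X^i` -/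
  lo : ℕ
  /-- `Σᵢ (uᵢ + M)·X^(r−1−i)` -/
  hi : ℕ
  /-- `Σᵢ uᵢ` -/
  s : ℤ

/-- Offset digits of a signed row. -/
def offDigits (M : ℤ) (u : List ℤ) : List ℕ := u.map fun x => (x + M).toNat

/-- **Encode a dense integer row** (once per row per module). -/
def mkKRow (b : ℕ) (M : ℤ) (u : List ℤ) : KRow :=
  ⟨evalLE (2 ^ b) (offDigits M u), evalLE (2 ^ b) (offDigits M u).reverse, u.sum⟩

/-- **Kronecker dot, precomputed form**: shift `sh = b·(r−1)` and mask `2^b − 1` supplied (hoisted once per block). -/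
def kdotP (sh mask : ℕ) (M : ℤ) (r : ℕ) (x y : KRow) : ℤ :=
  (((x.lo * y.hi) >>> sh) &&& mask : ℕ) - M * (x.s + y.s) - (r : ℤ) * M * M

/-- **Kronecker dot** of two encoded rows of length `r`: middle digit by shift + mask, minus the offset terms. -/
def kdot (b : ℕ) (M : ℤ) (r : ℕ) (x y : KRow) : ℤ := kdotP (b * (r - 1)) (2 ^ b - 1) M r x y

/-- The offset identity: `Σ (uᵢ+M)(vᵢ+M) = Σ uᵢvᵢ + M(Σu + Σv) + r·M²` for rows of length `r` with entries `≥ −M`. -/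
theorem ddotN_offDigits (M : ℤ) : ∀ (u v : List ℤ), u.length = v.length → (∀ x ∈ u, -M ≤ x) → (∀ x ∈ v, -M ≤ x) →
    (ddotN (offDigits M u) (offDigits M v) : ℤ) = ddot u v + M * (u.sum + v.sum) + (u.length : ℤ) * M * M
  | [], [], _, _, _ => by simp [ddotN, offDigits, ddot]
  | [], y :: v, h, _, _ => by simp at h
  | x :: u, [], h, _, _ => by simp at h
  | x :: u, y :: v, h, hu, hv => by
    have ih := ddotN_offDigits M u v (by simpa using h) (fun z hz => hu z (List.mem_cons_of_mem _ hz))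
      (fun z hz => hv z (List.mem_cons_of_mem _ hz))
    have hx : 0 ≤ x + M := by have := hu x List.mem_cons_self; omega
    have hy : 0 ≤ y + M := by have := hv y List.mem_cons_self; omega
    simp only [ddotN, offDigits, List.map_cons, List.zipWith_cons_cons, List.sum_cons, Nat.cast_add, Nat.cast_mul,
      Int.toNat_of_nonneg hx, Int.toNat_of_nonneg hy, ddot_cons, List.length_cons, Nat.cast_succ] at ih ⊢
    rw [ih]
    ring

/-- Offset digits are bounded by `2M − 1` when `|entries| < M`. -/
theorem offDigits_le (M : ℤ) (u : List ℤ) (hu : ∀ x ∈ u, -M ≤ x ∧ x < M) :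
    ∀ d ∈ offDigits M u, d ≤ (2 * M - 1).toNat := by
  intro d hd
  obtain ⟨x, hx, rfl⟩ := List.mem_map.1 hd
  have := hu x hx
  omega

/-- **THE BRIDGE: the Kronecker dot IS the dense dot** on rows of equal length `r ≥ 1` with `|entries| < M` and `r·(2M−1)² < 2^b`. -/
theorem kdot_mkKRow (b : ℕ) (M : ℤ) (r : ℕ) (u v : List ℤ) (hr : 0 < r) (hu : u.length = r) (hv : v.length = r)
    (hbu : ∀ x ∈ u, -M ≤ x ∧ x < M) (hbv : ∀ x ∈ v, -M ≤ x ∧ x < M)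
    (hb : r * (2 * M - 1).toNat * (2 * M - 1).toNat < 2 ^ b) :
    kdot b M r (mkKRow b M u) (mkKRow b M v) = ddot u v := by
  obtain ⟨r', rfl⟩ : ∃ r', r = r' + 1 := ⟨r - 1, by omega⟩
  unfold kdot kdotP mkKRow
  simp only
  rw [Nat.shiftRight_eq_div_pow, Nat.and_two_pow_sub_one_eq_mod, show b * (r' + 1 - 1) = b * r' by simp, pow_mul,
    kron_dotN (2 ^ b) r' ((2 * M - 1).toNat) (offDigits M u) (offDigits M v) (by simp [offDigits, hu]) (by simp [offDigits, hv])
      (offDigits_le M u hbu) (offDigits_le M v hbv) hb,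
    ddotN_offDigits M u v (by rw [hu, hv]) (fun x hx => (hbu x hx).1) (fun x hx => (hbv x hx).1), hu]
  push_cast
  ring

end Summit.Ventures.CertifiedManyBodySolver.Theorems.SymReplay
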